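import Mathlib
import Summits.Ventures.HodgeRepro2.Hypothesis
import Summits.Ventures.HodgeRepro2.Neat
import Summits.Ventures.HodgeRepro2.NeatTorsionFree
import Summits.Ventures.HodgeRepro2.T5CongruentRootOfUnity

/-!
# CongruenceNeat — the principal congruence subgroup `Γ(N)` is neat for `N > 2`
(DR15 Lemma 1.4; the Prop `DR15Lemma14Shape` of the Tier-3 annex)

`Neat.lean` (p2 file 8) states the Prop `DR15Lemma14Shape K τ H : ∀ N, 2 < N → IsNeat K τ
(principalCongruence K H (Ideal.span {N}))` — DR15's Lemma 1.4, «`Γ(N)` is neat for `N > 2`»,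
cited as printed. This file proves it.

The argument: for `γ ∈ Γ(N)` the matrix `A = τ(γ)` has algebraic-integer entries and
`A − 1 = N·B` with `B` of algebraic-integer entries (the congruence condition
`CongruentToOne`); every eigenvalue `z` of `A` (a root of the characteristic polynomial) is an
algebraic integer, so is `z⁻¹` (an eigenvalue of `τ(γ⁻¹)`), and `(z − 1)/N` is an eigenvalue of
`B`, hence integral: `z − 1 ∈ N·𝒪` and likewise `z⁻¹ − 1 = −z⁻¹(z − 1) ∈ N·𝒪`. These four
properties cut out a SUBGROUP `congrUnits N ⊆ ℂˣ`, which therefore contains the subgroup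
generated by the eigenvalues; and a root of unity in `congrUnits N` is `1` by
`T5CongruentRootOfUnity.eq_one_of_pow_eq_one_of_sub_one_eq_mul` (Minkowski's norm bound,
`N ≥ 3`).

* `isIntegral_of_mem_roots_charpoly` — eigenvalues of a matrix with integral entries are
  integral (`Matrix.charpoly_map`, `isIntegral_trans` through `integralClosure ℤ ℂ`);
* `mem_roots_charpoly_of_mulVec_eq_smul` — an eigenvector gives a root of the characteristic
  polynomial; `inv_mem_roots_charpoly_inv` — `z⁻¹` is an eigenvalue of `A⁻¹`;
* `congrUnits N` — the subgroup of `ℂˣ` of units `u` with `u, u⁻¹` integral and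
  `u − 1, u⁻¹ − 1 ∈ N·𝒪`;
* `eigenvalueUnits_subset_congrUnits` — for `γ ∈ Γ(N)` the eigenvalues lie in `congrUnits N`;
* **`dr15Lemma14Shape : DR15Lemma14Shape K τ H`** — `Γ(N)` is neat for `N > 2`.
-/

namespace Summit.Ventures.HodgeRepro2.ShimuraData

open Polynomial Matrix

/-! ## §1 Eigenvalues of matrices with integral entries -/

section Eigen

variable {m : ℕ}

/-- **Eigenvalues of a matrix with algebraic-integer entries are algebraic integers.** -/
theorem isIntegral_of_mem_roots_charpoly (A : Matrix (Fin m) (Fin m) ℂ)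
    (hA : ∀ i j, IsIntegral ℤ (A i j)) {z : ℂ} (hz : z ∈ A.charpoly.roots) :
    IsIntegral ℤ z := by
  -- the matrix with entries in the ring of algebraic integers `S = integralClosure ℤ ℂ`
  let S := integralClosure ℤ ℂ
  let A' : Matrix (Fin m) (Fin m) S := fun i j => ⟨A i j, hA i j⟩
  have hmap : A'.map (algebraMap S ℂ) = A := by
    ext i j; rfl
  have hroot : A.charpoly.IsRoot z := (mem_roots'.mp hz).2
  have hS : IsIntegral S z := by
    refine ⟨A'.charpoly, charpoly_monic A', ?_⟩
    rw [eval₂_eq_eval_map, ← charpoly_map, hmap]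
    exact hroot
  exact isIntegral_trans z hS

/-- An eigenvector gives a root of the characteristic polynomial. -/
theorem mem_roots_charpoly_of_mulVec_eq_smul (A : Matrix (Fin m) (Fin m) ℂ) {z : ℂ}
    {v : Fin m → ℂ} (hv : v ≠ 0) (hAv : A *ᵥ v = z • v) : z ∈ A.charpoly.roots := by
  rw [mem_roots (charpoly_monic A).ne_zero, IsRoot.def, eval_charpoly]
  rw [← exists_mulVec_eq_zero_iff]
  refine ⟨v, hv, ?_⟩
  rw [sub_mulVec, hAv, scalar_apply, sub_eq_zero]
  ext i
  rw [mulVec_diagonal, Pi.smul_apply, smul_eq_mul]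

/-- The eigenvalues of an invertible matrix are non-zero. -/
theorem ne_zero_of_mem_roots_charpoly_of_isUnit (A : Matrix (Fin m) (Fin m) ℂ) (hA : IsUnit A)
    {z : ℂ} (hz : z ∈ A.charpoly.roots) : z ≠ 0 := by
  intro h0
  obtain ⟨v, hv, hAv⟩ := exists_mulVec_eq_smul_of_mem_roots A hz
  rw [h0, zero_smul] at hAv
  obtain ⟨u, hu⟩ := hA
  have : v = 0 := by
    have h1 := congrArg (fun w => (↑u⁻¹ : Matrix (Fin m) (Fin m) ℂ) *ᵥ w) hAv
    simp only [mulVec_mulVec, mulVec_zero] at h1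
    rw [← hu, Units.inv_mul, one_mulVec] at h1
    exact h1
  exact hv this

/-- `z⁻¹` is an eigenvalue of `A⁻¹` when `z` is an eigenvalue of the invertible `A`. -/
theorem inv_mem_roots_charpoly_inv (A : GL (Fin m) ℂ) {z : ℂ}
    (hz : z ∈ (A : Matrix (Fin m) (Fin m) ℂ).charpoly.roots) :
    z⁻¹ ∈ ((A⁻¹ : GL (Fin m) ℂ) : Matrix (Fin m) (Fin m) ℂ).charpoly.roots := by
  have hz0 : z ≠ 0 := ne_zero_of_mem_roots_charpoly_of_isUnit _ ⟨A, rfl⟩ hz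
  obtain ⟨v, hv, hAv⟩ := exists_mulVec_eq_smul_of_mem_roots _ hz
  apply mem_roots_charpoly_of_mulVec_eq_smul _ hv
  -- `A⁻¹ v = z⁻¹ v`: apply `A⁻¹` to `A v = z v`
  have h1 := congrArg (fun w => ((A⁻¹ : GL (Fin m) ℂ) : Matrix (Fin m) (Fin m) ℂ) *ᵥ w) hAv
  simp only [mulVec_mulVec, mulVec_smul] at h1
  rw [Units.inv_mul, one_mulVec] at h1
  -- h1 : v = z • (A⁻¹ v)
  calc ((A⁻¹ : GL (Fin m) ℂ) : Matrix (Fin m) (Fin m) ℂ) *ᵥ v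
      = z⁻¹ • (z • (((A⁻¹ : GL (Fin m) ℂ) : Matrix (Fin m) (Fin m) ℂ) *ᵥ v)) := by
        rw [smul_smul, inv_mul_cancel₀ hz0, one_smul]
    _ = z⁻¹ • v := by rw [← h1]

/-- If `A − 1 = N·B` and `A v = z v`, then `B v = ((z − 1)/N) • v`. -/
theorem mulVec_eq_smul_of_sub_one_eq (A B : Matrix (Fin m) (Fin m) ℂ) {N : ℕ} (hN : N ≠ 0)
    (hAB : A - 1 = (N : ℂ) • B) {z : ℂ} {v : Fin m → ℂ} (hAv : A *ᵥ v = z • v) :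
    B *ᵥ v = ((z - 1) / N) • v := by
  have hN' : (N : ℂ) ≠ 0 := Nat.cast_ne_zero.mpr hN
  have h1 : (A - 1) *ᵥ v = (z - 1) • v := by
    rw [sub_mulVec, one_mulVec, hAv, sub_smul, one_smul]
  rw [hAB, smul_mulVec] at h1
  have h2 : B *ᵥ v = (N : ℂ)⁻¹ • ((N : ℂ) • B *ᵥ v) := by
    rw [smul_smul, inv_mul_cancel₀ hN', one_smul]
  rw [h2, h1, smul_smul, div_eq_inv_mul]

end Eigen

/-! ## §2 The subgroup of units congruent to `1` modulo `N` -/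

section CongrUnits

/-- The property «`u` is an algebraic integer and `u − 1 ∈ N·𝒪`». -/
def IsCongrOne (N : ℕ) (u : ℂ) : Prop :=
  IsIntegral ℤ u ∧ ∃ w : ℂ, IsIntegral ℤ w ∧ u - 1 = (N : ℂ) * w

/-- `1` is congruent to `1`. -/
theorem isCongrOne_one (N : ℕ) : IsCongrOne N 1 :=
  ⟨isIntegral_one, 0, isIntegral_zero, by simp⟩

/-- Units congruent to `1` modulo `N` are closed under multiplication. -/
theorem IsCongrOne.mul {N : ℕ} {u v : ℂ} (hu : IsCongrOne N u) (hv : IsCongrOne N v) :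
    IsCongrOne N (u * v) := by
  obtain ⟨hu, w₁, hw₁, h₁⟩ := hu
  obtain ⟨hv, w₂, hw₂, h₂⟩ := hv
  refine ⟨hu.mul hv, (N : ℂ) * w₁ * w₂ + w₁ + w₂, ?_, ?_⟩
  · exact ((((isIntegral_natCast N).mul hw₁).mul hw₂).add hw₁).add hw₂
  · have : u * v - 1 = (u - 1) * (v - 1) + (u - 1) + (v - 1) := by ring
    rw [this, h₁, h₂]
    ring

/-- The subgroup of `ℂˣ` of units `u` with `u` and `u⁻¹` both congruent to `1` modulo `N`. -/
def congrUnits (N : ℕ) : Subgroup ℂˣ where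
  carrier := {u | IsCongrOne N (u : ℂ) ∧ IsCongrOne N ((u⁻¹ : ℂˣ) : ℂ)}
  one_mem' := by
    simp only [Set.mem_setOf_eq, inv_one, Units.val_one]
    exact ⟨isCongrOne_one N, isCongrOne_one N⟩
  mul_mem' := by
    intro u v hu hv
    simp only [Set.mem_setOf_eq, Units.val_mul, _root_.mul_inv_rev] at hu hv ⊢
    exact ⟨hu.1.mul hv.1, hv.2.mul hu.2⟩
  inv_mem' := by
    intro u hu
    simp only [Set.mem_setOf_eq, inv_inv] at hu ⊢
    exact ⟨hu.2, hu.1⟩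

/-- Membership in `congrUnits N`. -/
theorem mem_congrUnits {N : ℕ} {u : ℂˣ} :
    u ∈ congrUnits N ↔ IsCongrOne N (u : ℂ) ∧ IsCongrOne N ((u⁻¹ : ℂˣ) : ℂ) := Iff.rfl

/-- A root of unity in `congrUnits N` is `1` when `N ≥ 3`. -/
theorem eq_one_of_mem_congrUnits_of_pow_eq_one {N : ℕ} (hN : 3 ≤ N) {u : ℂˣ}
    (hu : u ∈ congrUnits N) {n : ℕ} (hn : 0 < n) (hpow : u ^ n = 1) : u = 1 := by
  obtain ⟨⟨_, w, hw, hwu⟩, _⟩ := hu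
  have hpow' : (u : ℂ) ^ n = 1 := by
    rw [← Units.val_pow_eq_pow_val, hpow, Units.val_one]
  have := T5CongruentRootOfUnity.eq_one_of_pow_eq_one_of_sub_one_eq_mul hw hN hwu hn hpow'
  exact Units.ext this

end CongrUnits

/-! ## §3 The eigenvalues of `Γ(N)` lie in `congrUnits N` -/

section Gamma

variable {K : Type*} [Field K] [NumberField K] [NumberField.IsCMField K] {m : ℕ}

omit [NumberField K] [NumberField.IsCMField K] in
/-- For `γ` with integral entries, the entries of `τ(γ)` are algebraic integers. -/
theorem isIntegral_map_entries (τ : K →+* ℂ) (γ : Matrix (Fin m) (Fin m) K)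
    (hγ : ∀ i j, IsIntegral ℤ (γ i j)) (i j : Fin m) : IsIntegral ℤ ((γ.map τ) i j) :=
  map_isIntegral_int τ (hγ i j)

omit [NumberField.IsCMField K] in
/-- The congruence condition gives `τ(γ) − 1 = N·B` with `B` of integral entries. -/
theorem exists_integral_matrix_of_congruentToOne (τ : K →+* ℂ) (γ : Matrix (Fin m) (Fin m) K)
    {N : ℕ} (hγ : CongruentToOne K (Ideal.span {(N : NumberField.RingOfIntegers K)}) γ) :
    ∃ B : Matrix (Fin m) (Fin m) ℂ, (∀ i j, IsIntegral ℤ (B i j)) ∧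
      γ.map τ - 1 = (N : ℂ) • B := by
  choose a ha hγa using hγ
  -- `a i j ∈ (N)`: `a i j = N * b i j`
  have hb : ∀ i j, ∃ b : NumberField.RingOfIntegers K, a i j = (N : NumberField.RingOfIntegers K) * b :=
    fun i j => Ideal.mem_span_singleton.mp (ha i j)
  choose b hb using hb
  refine ⟨fun i j => τ (algebraMap (NumberField.RingOfIntegers K) K (b i j)), ?_, ?_⟩
  · intro i j
    exact map_isIntegral_int τ (NumberField.RingOfIntegers.isIntegral_coe (b i j))
  · ext i j
    rw [Matrix.sub_apply, Matrix.map_apply, Matrix.smul_apply, smul_eq_mul]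
    have hone : ((1 : Matrix (Fin m) (Fin m) ℂ) i j) = τ ((1 : Matrix (Fin m) (Fin m) K) i j) := by
      rw [Matrix.one_apply, Matrix.one_apply]
      split_ifs <;> simp
    rw [hone, ← map_sub, hγa i j, hb i j, map_mul, map_mul, map_natCast, map_natCast]

/-- **The eigenvalues of `γ ∈ Γ(N)` lie in `congrUnits N`.** -/
theorem eigenvalueUnits_subset_congrUnits (τ : K →+* ℂ) (H : Matrix (Fin m) (Fin m) K)
    {N : ℕ} (hN : N ≠ 0) {γ : GL (Fin m) K}
    (hγ : γ ∈ principalCongruence K H (Ideal.span {(N : NumberField.RingOfIntegers K)})) :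
    eigenvalueUnits K τ γ ⊆ congrUnits N := by
  obtain ⟨⟨_, hint, hintinv⟩, hcong⟩ := hγ
  intro u hu
  -- `hu : (u : ℂ) ∈ (τ(γ)).charpoly.roots`
  have hu' : (u : ℂ) ∈ ((γ : Matrix (Fin m) (Fin m) K).map τ).charpoly.roots := hu
  set A : Matrix (Fin m) (Fin m) ℂ := (γ : Matrix (Fin m) (Fin m) K).map τ with hA
  -- `A` as an element of `GL`
  let Aunit : GL (Fin m) ℂ := Units.map (RingHom.mapMatrix τ).toMonoidHom γ
  have hAunit : (Aunit : Matrix (Fin m) (Fin m) ℂ) = A := rfl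
  have hAinv : ((Aunit⁻¹ : GL (Fin m) ℂ) : Matrix (Fin m) (Fin m) ℂ) =
      ((γ⁻¹ : GL (Fin m) K) : Matrix (Fin m) (Fin m) K).map τ := by
    exact Units.coe_map_inv (RingHom.mapMatrix τ).toMonoidHom γ
  -- (i) `u` is integral
  have h1 : IsIntegral ℤ (u : ℂ) :=
    isIntegral_of_mem_roots_charpoly A (fun i j => isIntegral_map_entries τ _ hint i j) hu'
  -- (ii) `u⁻¹` is integral
  have hu'' : (u : ℂ) ∈ (Aunit : Matrix (Fin m) (Fin m) ℂ).charpoly.roots := by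
    rw [hAunit]; exact hu'
  have hinv_root := inv_mem_roots_charpoly_inv Aunit hu''
  rw [hAinv] at hinv_root
  have h2 : IsIntegral ℤ ((u : ℂ)⁻¹) :=
    isIntegral_of_mem_roots_charpoly _ (fun i j => isIntegral_map_entries τ _ hintinv i j)
      hinv_root
  -- (iii) `u − 1 = N·w` with `w` integral
  obtain ⟨B, hB, hAB⟩ := exists_integral_matrix_of_congruentToOne τ _ hcong
  obtain ⟨v, hv, hAv⟩ := exists_mulVec_eq_smul_of_mem_roots A hu'
  have hBv := mulVec_eq_smul_of_sub_one_eq A B hN hAB hAv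
  have h3 : IsIntegral ℤ (((u : ℂ) - 1) / N) :=
    isIntegral_of_mem_roots_charpoly B hB (mem_roots_charpoly_of_mulVec_eq_smul B hv hBv)
  have hN' : (N : ℂ) ≠ 0 := Nat.cast_ne_zero.mpr hN
  have h3' : (u : ℂ) - 1 = (N : ℂ) * (((u : ℂ) - 1) / N) := by
    rw [mul_div_cancel₀ _ hN']
  -- (iv) `u⁻¹ − 1 = −u⁻¹ (u − 1)`
  have hu0 : (u : ℂ) ≠ 0 := u.ne_zero
  have h4 : ((u : ℂ)⁻¹) - 1 = (N : ℂ) * (-(u : ℂ)⁻¹ * (((u : ℂ) - 1) / N)) := by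
    field_simp
    ring
  refine ⟨⟨h1, _, h3, h3'⟩, ?_⟩
  rw [Units.val_inv_eq_inv_val]
  exact ⟨h2, _, (h2.neg).mul h3, h4⟩

/-- **DR15 Lemma 1.4: `Γ(N)` is neat for `N > 2`.** -/
theorem dr15Lemma14Shape (τ : K →+* ℂ) (H : Matrix (Fin m) (Fin m) K) :
    DR15Lemma14Shape K τ H := by
  intro N hN γ hγ z hz n hn hpow
  have hN0 : N ≠ 0 := by omega
  have hN3 : 3 ≤ N := by omega
  have hsub : Subgroup.closure (eigenvalueUnits K τ γ) ≤ congrUnits N :=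
    (Subgroup.closure_le _).mpr (eigenvalueUnits_subset_congrUnits τ H hN0 hγ)
  exact eq_one_of_mem_congrUnits_of_pow_eq_one hN3 (hsub hz) hn hpow

end Gamma

end Summit.Ventures.HodgeRepro2.ShimuraData
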